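import Mathlib
import Summits.Ventures.PercRepro2.SwOutCrossJunctionReal

/-!
# The base is read off every non-leaking point of its block (blind cell PercRepro2, night-4
g24, 2026-08-28; proofs/NIGHT4-G24.md §5)

**The reading lemma** `CrossBase.baseX_crossReal`: for a cross base `σ` and a point `q` of its
cube without red- or blue-side leak, `baseX (crossReal σ q) = σ`.  By the hull formulas of
g23 the blue side of `h` at the realisation consists of the blue u-arms, the blue far arms and —
when some u-arm is blue — `u` and the blue-attached dropped vertices; so flipping it restores the
colours of the arms, and the forcing restores the colours of the classes at `u` and at the dropped
vertices; off the classes nothing changes.  Consequences for a cross junction: every non-leaking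
point of the block of a core-kind class point lies in the outside class
(`crossReal_mem_outClass`), and the block of a core-kind class point satisfies the rigid
inequality (`card_blockX_le`, from the block theorem `rigid_block_cross` of g23).
-/

namespace Summit.Ventures.PercRepro2

namespace CrossArm

open Hull LocRows

variable {V : Type*} {E : Type*} [Fintype E] [DecidableEq E]

open scoped Classical

section Read

variable {ends : E → Sym2 V} {σ : Config E} {h u : V} {ι X κ : Type*} {U : ι → Set V}
  {p : X → V} {G : SimpleGraph X} {F : κ → Set V} (hb : CrossBase ends σ h u U p G F)
  (hup : ∀ i, ∃ e, ends e = s(u, p i)) (hcross : ∀ i j, G.Adj i j → ∃ e, ends e = s(p i, p j))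
include hb hup hcross

variable {q : PtXG ι κ X G} (hqR : ¬ LeakRX G q) (hqB : ¬ LeakBX G q)
include hqR hqB

omit [Fintype E] [DecidableEq E] in
/-- Membership in the blue side of `h` at a realisation. -/
lemma CrossBase.mem_bside_crossReal_iff {x : V} :
    x ∈ bside ends (crossReal ends u U p G F σ q) h ↔
      x ∈ redSetX h u U p G F (flipXG G q) ∧ x ∉ redSetX h u U p G F q := by
  rw [mem_bside_iff, hb.cluster_crossReal hup hcross hqR, hb.cluster_blue_crossReal hup hcross hqB]

omit [Fintype E] [DecidableEq E] in
/-- `h` is not on the blue side. -/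
lemma CrossBase.h_notMem_bside : h ∉ bside ends (crossReal ends u U p G F σ q) h :=
  fun hx => ((hb.mem_bside_crossReal_iff hup hcross hqR hqB).1 hx).2 (by
    rw [mem_redSetX_iff]; exact Or.inl rfl)

omit [Fintype E] [DecidableEq E] in
/-- A vertex outside the structure is not on the blue side. -/
lemma CrossBase.notMem_bside_of_out {y : V} (hyh : y ≠ h) (hyu : y ≠ u) (hyp : ∀ i, y ≠ p i)
    (hy : y ∉ armsAllX U F) : y ∉ bside ends (crossReal ends u U p G F σ q) h := by
  intro hy'
  rcases hb.hull_crossReal_subset hup hcross hqR hqB (Or.inr hy'.1) with h' | h' | ⟨i, h'⟩ | h'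
  · exact hyh h'
  · exact hyu h'
  · exact hyp i h'
  · exact hy h'

omit [Fintype E] [DecidableEq E] in
/-- A vertex of a red u-arm is not on the blue side. -/
lemma CrossBase.notMem_bside_U_red {j : ι} (hj : q.2.1 j = true) {x : V} (hx : x ∈ U j) :
    x ∉ bside ends (crossReal ends u U p G F σ q) h :=
  fun hx' => ((hb.mem_bside_crossReal_iff hup hcross hqR hqB).1 hx').2 (by
    rw [mem_redSetX_iff]; exact Or.inr (Or.inl ⟨j, hj, hx⟩))

omit [Fintype E] [DecidableEq E] in
/-- A vertex of a blue u-arm is on the blue side. -/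
lemma CrossBase.mem_bside_U_blue {j : ι} (hj : q.2.1 j = false) {x : V} (hx : x ∈ U j) :
    x ∈ bside ends (crossReal ends u U p G F σ q) h := by
  rw [hb.mem_bside_crossReal_iff hup hcross hqR hqB, mem_redSetX_iff, mem_redSetX_iff]
  refine ⟨Or.inr (Or.inl ⟨j, by simp [flipXG, flipAll, hj], hx⟩), ?_⟩
  rintro (rfl | ⟨j', hj', hx'⟩ | ⟨rfl, -⟩ | ⟨i, rfl, -, -⟩ | ⟨k, -, hx'⟩)
  · exact hb.h_notMem_U j hx
  · by_cases hjj : j = j'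
    · subst hjj; rw [hj] at hj'; exact Bool.noConfusion hj'
    · exact hb.U_disj j j' hjj x hx hx'
  · exact hb.u_notMem_U j hx
  · exact hb.p_notMem_U i j hx
  · exact hb.U_disj_F j k x hx hx'

omit [Fintype E] [DecidableEq E] in
/-- A vertex of a red far arm is not on the blue side. -/
lemma CrossBase.notMem_bside_F_red {k : κ} (hk : q.1 k = true) {x : V} (hx : x ∈ F k) :
    x ∉ bside ends (crossReal ends u U p G F σ q) h :=
  fun hx' => ((hb.mem_bside_crossReal_iff hup hcross hqR hqB).1 hx').2 (by
    rw [mem_redSetX_iff]; exact Or.inr (Or.inr (Or.inr (Or.inr ⟨k, hk, hx⟩))))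

omit [Fintype E] [DecidableEq E] in
/-- A vertex of a blue far arm is on the blue side. -/
lemma CrossBase.mem_bside_F_blue {k : κ} (hk : q.1 k = false) {x : V} (hx : x ∈ F k) :
    x ∈ bside ends (crossReal ends u U p G F σ q) h := by
  rw [hb.mem_bside_crossReal_iff hup hcross hqR hqB, mem_redSetX_iff, mem_redSetX_iff]
  refine ⟨Or.inr (Or.inr (Or.inr (Or.inr ⟨k, by simp [flipXG, flipAll, hk], hx⟩))), ?_⟩
  rintro (rfl | ⟨j, -, hx'⟩ | ⟨rfl, -⟩ | ⟨i, rfl, -, -⟩ | ⟨k', hk', hx'⟩)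
  · exact hb.h_notMem_F k hx
  · exact hb.U_disj_F j k x hx' hx
  · exact hb.u_notMem_F k hx
  · exact hb.p_notMem_F i k hx
  · by_cases hkk : k = k'
    · subst hkk; rw [hk] at hk'; exact Bool.noConfusion hk'
    · exact hb.F_disj k k' hkk x hx hx'

omit [Fintype E] [DecidableEq E] in
/-- With a red u-arm, `u` is not on the blue side. -/
lemma CrossBase.u_notMem_bside_of_red {j : ι} (hj : q.2.1 j = true) :
    u ∉ bside ends (crossReal ends u U p G F σ q) h :=
  fun hx' => ((hb.mem_bside_crossReal_iff hup hcross hqR hqB).1 hx').2 (by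
    rw [mem_redSetX_iff]; exact Or.inr (Or.inr (Or.inl ⟨rfl, j, hj⟩)))

omit [Fintype E] [DecidableEq E] in
/-- The base is read off an edge touching a u-arm. -/
lemma CrossBase.baseX_crossReal_U {j : ι} {e : E} (he : e ∈ touches ends (U j)) :
    baseX ends h u p (crossReal ends u U p G F σ q) e = σ e := by
  obtain ⟨x, y, hxy, hx, hy⟩ := hb.ends_of_touches_U he
  have hnp : ∀ i, p i ∉ ends e := by
    intro i hi
    rw [hxy] at hi
    rcases Sym2.mem_iff.1 hi with h' | h'
    · exact hb.p_notMem_U i j (h' ▸ hx)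
    · rcases hy with hy | hy | hy | ⟨-, -, hyp, -⟩
      · exact hb.p_notMem_U i j (h' ▸ hy)
      · exact hb.hne_hp i (hy.symm.trans h'.symm)
      · exact hb.hne_up i (hy.symm.trans h'.symm)
      · exact hyp i h'.symm
  rw [baseX, crossForce_of_not_p hnp]
  cases hj : q.2.1 j with
  | true =>
    have hnt : e ∉ touches ends (bside ends (crossReal ends u U p G F σ q) h) := by
      rintro ⟨z, hz, w, hzw⟩
      rw [hxy, Sym2.eq_iff] at hzw
      have hzx : z = x ∨ z = y := by
        rcases hzw with ⟨h1, -⟩ | ⟨-, h2⟩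
        · exact Or.inl h1.symm
        · exact Or.inr h2.symm
      rcases hzx with rfl | rfl
      · exact hb.notMem_bside_U_red hup hcross hqR hqB hj hx hz
      · rcases hy with hy | rfl | rfl | ⟨hyh, hyu, hyp, hyA⟩
        · exact hb.notMem_bside_U_red hup hcross hqR hqB hj hy hz
        · exact hb.h_notMem_bside hup hcross hqR hqB hz
        · exact hb.u_notMem_bside_of_red hup hcross hqR hqB hj hz
        · exact hb.notMem_bside_of_out hup hcross hqR hqB hyh hyu hyp hyA hz
    rw [flip_apply_of_notMem hnt, hb.crossReal_apply_U he, if_pos hj]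
  | false =>
    rw [flip_apply_of_mem (show e ∈ touches ends
      (bside ends (crossReal ends u U p G F σ q) h) from
        ⟨x, hb.mem_bside_U_blue hup hcross hqR hqB hj hx, y, hxy⟩), hb.crossReal_apply_U he,
      if_neg (by simp [hj]), Bool.not_not]

omit [Fintype E] [DecidableEq E] in
/-- The base is read off an edge touching a far arm. -/
lemma CrossBase.baseX_crossReal_F {k : κ} {e : E} (he : e ∈ touches ends (F k)) :
    baseX ends h u p (crossReal ends u U p G F σ q) e = σ e := by
  obtain ⟨x, y, hxy, hx, hy⟩ := hb.ends_of_touches_F he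
  have hnp : ∀ i, p i ∉ ends e := by
    intro i hi
    rw [hxy] at hi
    rcases Sym2.mem_iff.1 hi with h' | h'
    · exact hb.p_notMem_F i k (h' ▸ hx)
    · rcases hy with hy | hy | ⟨-, -, hyp, -⟩
      · exact hb.p_notMem_F i k (h' ▸ hy)
      · exact hb.hne_hp i (hy.symm.trans h'.symm)
      · exact hyp i h'.symm
  rw [baseX, crossForce_of_not_p hnp]
  cases hk : q.1 k with
  | true =>
    have hnt : e ∉ touches ends (bside ends (crossReal ends u U p G F σ q) h) := by
      rintro ⟨z, hz, w, hzw⟩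
      rw [hxy, Sym2.eq_iff] at hzw
      have hzx : z = x ∨ z = y := by
        rcases hzw with ⟨h1, -⟩ | ⟨-, h2⟩
        · exact Or.inl h1.symm
        · exact Or.inr h2.symm
      rcases hzx with rfl | rfl
      · exact hb.notMem_bside_F_red hup hcross hqR hqB hk hx hz
      · rcases hy with hy | rfl | ⟨hyh, hyu, hyp, hyA⟩
        · exact hb.notMem_bside_F_red hup hcross hqR hqB hk hy hz
        · exact hb.h_notMem_bside hup hcross hqR hqB hz
        · exact hb.notMem_bside_of_out hup hcross hqR hqB hyh hyu hyp hyA hz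
    rw [flip_apply_of_notMem hnt, hb.crossReal_apply_F he, if_pos hk]
  | false =>
    rw [flip_apply_of_mem (show e ∈ touches ends
      (bside ends (crossReal ends u U p G F σ q) h) from
        ⟨x, hb.mem_bside_F_blue hup hcross hqR hqB hk hx, y, hxy⟩), hb.crossReal_apply_F he,
      if_neg (by simp [hk]), Bool.not_not]

omit [Fintype E] [DecidableEq E] in
/-- **THE READING LEMMA: the base is read off every non-leaking point of its block.** -/
theorem CrossBase.baseX_crossReal :
    baseX ends h u p (crossReal ends u U p G F σ q) = σ := by
  funext e
  by_cases hF : ∃ k, e ∈ touches ends (F k)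
  · obtain ⟨k, hk⟩ := hF
    exact hb.baseX_crossReal_F hup hcross hqR hqB hk
  by_cases hU : ∃ j, e ∈ touches ends (U j)
  · obtain ⟨j, hj⟩ := hU
    exact hb.baseX_crossReal_U hup hcross hqR hqB hj
  by_cases hUP : ∃ i, e ∈ clsUPX ends u p i
  · obtain ⟨i, hi⟩ := hUP
    have he : ends e = s(u, p i) := hi
    rw [baseX_UP he, hb.u_red e (p i) he]
  by_cases hC : ∃ s, e ∈ clsCX ends p G s
  · obtain ⟨s, i, j, -, he⟩ := hC
    rw [baseX_C he, hb.cross_red i j e he]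
  by_cases hX : ∃ i, e ∈ clsExtX ends u p i
  · obtain ⟨i, x, he, hxu, hxp⟩ := hX
    rw [show baseX ends h u p (crossReal ends u U p G F σ q) e = false from
      crossForce_Ext hb.hne_up he hxu hxp, hb.ext_blue i e x he hxu hxp]
  · simp only [not_exists] at hF hU hUP hC hX
    have hnone := CrossBase.crossReal_apply_none (σ := σ) (q := q) hF hU hUP hC hX
    -- an edge in no class is at no dropped vertex and touches the structure at most at `h`
    have hnp : ∀ i, p i ∉ ends e := by
      intro i hi
      obtain ⟨x, hx⟩ := Sym2.mem_iff_exists.1 hi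
      rcases hb.p_edges i e x hx with rfl | ⟨j, rfl, hadj⟩ | ⟨-, hxu, hxp, -⟩
      · exact hUP i (ends_swap hx)
      · exact hC ⟨s(i, j), G.mem_edgeSet.2 hadj⟩ ⟨i, j, rfl, hx⟩
      · exact hX i ⟨x, hx, hxu, hxp⟩
    rw [baseX, crossForce_of_not_p hnp, flip_apply_of_notMem, hnone]
    rintro ⟨x, hx, y, hxy⟩
    rcases hb.hull_crossReal_subset hup hcross hqR hqB (Or.inr hx.1) with rfl | rfl | ⟨i, rfl⟩ | hxA
    · exact hb.h_notMem_bside hup hcross hqR hqB hx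
    · rcases hb.u_edges e y hxy with ⟨j, hy⟩ | ⟨i, rfl⟩
      · exact hU j ⟨y, hy, x, ends_swap hxy⟩
      · exact hUP i hxy
    · exact hnp i (by rw [hxy]; exact Sym2.mem_mk_left _ _)
    · rcases mem_armsAllX_iff.1 hxA with ⟨j, hj⟩ | ⟨k, hk⟩
      · exact hU j ⟨x, hj, y, hxy⟩
      · exact hF k ⟨x, hk, y, hxy⟩

end Read

section Junction

variable {ends : E → Sym2 V} {X : Type*} {U : Set V} {ξ : Config E} {l h o u : V} {p : X → V}
  {G : SimpleGraph X} [Fintype X] [DecidableRel G.Adj]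

variable (hj : CrossJunction ends U h u p G o) (hl : l ∉ U) {ζ : Config E}
  (hζ : ζ ∈ swOutSide ends l h o U ξ) (hk : CoreKind ends U h u ζ)
include hj hl hζ hk

omit [Fintype X] [DecidableRel G.Adj] in
/-- Every non-leaking point of the block of a core-kind class point lies in the outside class. -/
theorem CrossJunction.crossReal_mem_outClass
    {q : PtXG (ιX ends h u p (baseX ends h u p ζ)) (κX ends h u p (baseX ends h u p ζ)) X G}
    (hqR : ¬ LeakRX G q) (hqB : ¬ LeakBX G q) :
    crossReal ends u (UX ends h u p (baseX ends h u p ζ)) p G (FX ends h u p (baseX ends h u p ζ))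
      (baseX ends h u p ζ) q ∈ outClass ends U h ξ := by
  have hb := hj.crossBase_of_coreKind hl hζ hk
  have hstr := hj.strX_subset_U hl hζ hk
  rw [mem_outClass]
  refine ⟨fun e he => ?_, fun x hx => ?_⟩
  · have hnt : ∀ S : Set V, S ⊆ U → e ∉ touches ends S := fun S hS ⟨x, hx, y, hxy⟩ =>
      he ⟨x, hS hx, y, hxy⟩
    rw [CrossBase.crossReal_apply_none]
    · rw [baseX_apply_of_notMem_touches hj.hpU
        ((mem_outClass.1 (mem_swOutSide.1 hζ).2).2) he]
      exact (mem_outClass.1 (mem_swOutSide.1 hζ).2).1 e he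
    · intro k hk'
      exact hnt (FX ends h u p (baseX ends h u p ζ) k)
        (fun x hx => hstr (Or.inr (Or.inr (Or.inr (mem_armsAllX_of_F hx))))) hk'
    · intro j hj'
      exact hnt (UX ends h u p (baseX ends h u p ζ) j)
        (fun x hx => hstr (Or.inr (Or.inr (Or.inr (mem_armsAllX_of_U hx))))) hj'
    · intro i hi
      exact he ⟨u, hj.huU, p i, hi⟩
    · rintro s ⟨i, j, -, hij⟩
      exact he ⟨p i, hj.hpU i, p j, hij⟩
    · rintro i ⟨x, hx, -, -⟩
      exact he ⟨p i, hj.hpU i, x, hx⟩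
  · exact hstr (hb.hull_crossReal_subset hj.hup hj.hcross hqR hqB hx)

/-- **The block of a core-kind class point satisfies the rigid inequality** (the block theorem
`rigid_block_cross` of g23). -/
theorem CrossJunction.card_blockX_le (hG : G.Connected) {𝓔 : Set (Set E)} (h𝓔 : IsUpperSet 𝓔) :
    ((blockX ends h u p G (baseX ends h u p ζ)).filter fun ζ' =>
        ζ' ∈ tgtU ends l h {S : Set V | o ∈ S} ∧ redEdges ends ζ' h ∈ 𝓔).card ≤
      ((blockX ends h u p G (baseX ends h u p ζ)).filter fun ζ' =>
        ζ' ∈ tgtU ends l h {S : Set V | o ∈ S} ∧ blueEdges ends ζ' h ∈ 𝓔).card := by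
  haveI := hj.nonempty_ιX hl hζ hk
  haveI := hG.nonempty
  have hb := hj.crossBase_of_coreKind hl hζ hk
  have hlstr : l ∉ strX h u (UX ends h u p (baseX ends h u p ζ)) p (FX ends h u p (baseX ends h u p ζ)) :=
    fun hl' => hl (hj.strX_subset_U hl hζ hk hl')
  exact hb.rigid_block_cross hG hj.hup hj.hcross (hj.exists_clsCX) (hj.hFe_baseX hl hζ hk)
    hj.exists_clsExtX hlstr hj.hou hj.hop h𝓔

end Junction

end CrossArm

end Summit.Ventures.PercRepro2
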